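import Mathlib
import Literature.Probability.RandomPlanarGeometry.HexParafermion
import Literature.Probability.RandomPlanarGeometry.HexSAW
import Literature.Probability.RandomPlanarGeometry.HexSAWLattice

/-!
# Orientation API for the line `bridge-gate-renewal` of the crux `SAWDefectDecoherence.ObservableToSLER`
(stmt-CriticalPhenomena-14005): signed rows `rowOf k` versus the half-planes `{0 < im(conj(ζ^k) z)}`

Support file for stubs 3 (`stub_orientationTransfer`), 5 (`stub_carvedToSLE`), 6 (`stub_gateTransfer`)
of the lead's skeleton.  The orientation-free hypothesis `R6` of the line couples, at each marked
point `p`, a FLAT clause `D ∩ B(p, ρ) = {z | 0 < im(conj(ζ^k) (z − p))} ∩ B(p, ρ)`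
(`ζ = triZeta = e^{iπ/3}`, `k : Fin 6`) with a LATTICE clause `v ∈ Λ_δ ↔ m ≤ rowOf k v` near `p`.
This file is the machine check that the sign table of `rowOf` matches the flat clause:
* `skewCoord_hexCenter_eq` & co.: the skew coordinates of a face centre lie in
  `[rowCoord + 1/3, rowCoord + 2/3]`; `rowCoord i v = ⌊skewCoord i (hexCenter v)⌋`, no centre on a line;
* `triZeta_pow_re_im`, `im_conj_triZeta_pow_mul`: `im(conj(ζ^k) z) = (√3/2)·σ_k·skewCoord j_k z`
  with `(σ_k, j_k) = (rowSign k, rowAxis k)` — the SAME table as `rowOf` (`rowOf_eq`);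
* CONSISTENCY `le_rowOf_iff` / `rowOf_lt_iff`: `m ≤ rowOf k v ↔ lineLevel k m < im(conj(ζ^k) c_v)`:
  the exact half-lattice `{v | m ≤ rowOf k v}` is the set of faces whose centres lie strictly (margin
  `√3/6`, `abs_im_sub_lineLevel_ge`) on the side `ζ^k·i` of the `𝕋`-line
  `{im(conj(ζ^k) z) = lineLevel k m}` of direction `ζ^k`; `rowOf_add_three`, `triZeta_pow_add_three`
  (`k ↦ k + 3` is the opposite side of the same line family);
* GATES (`gate_data`): along a honeycomb edge `p ~ q` exactly one class `k` has
  `rowOf k q = rowOf k p + 1` (`existsUnique_gateClass`), the antipode drops by one, the four others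
  are unchanged; the dual edge is the normal `c_q − c_p = (i/√3) ζ^k` (`hexCenter_sub_hexCenter_of_gate`);
  the mid-edge `hexMidpoint s(p, q)` (`= gatePoint 1 p q` of the line's vocabulary) lies ON the line
  of level `rowOf k p + 1` (`im_conj_triZeta_pow_mul_hexMidpoint`), so the far half-lattice is
  literally `R6`'s flat clause centred at the gate point, at every mesh `δ`:
  `rowOf k p + 1 ≤ rowOf k v ↔ 0 < im(conj(ζ^k) (δ c_v − δ g))` (`rowOf_lt_rowOf_iff_of_gate(_smul)`).

`rowCoord`, `rowOf`, `skewCoord` are VERBATIM the lead's vocabulary file (`work/GateDefs.lean`,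
proposed as `Theorems/SAWDefectDecoherenceObservableToSLERGateDefs.lean`, not in the tree when this
file was written), in the same namespace, so that fully qualified names agree; whichever file lands
second imports the other and drops its copy.  Sources: H. Duminil-Copin, S. Smirnov, Ann. of Math. 175
(2012) (arXiv:1007.0575) §2 (honeycomb = faces of `𝕋`, mid-edges); refuter audit
`Cruxes/ObservableToSLER/Disproof.lean` §8, §13 (`orientSign`, `orientFamily`: the same table).
Deliberately NOT here: anything about domains, crosscuts, walks or the observable.
-/

noncomputable section

open scoped BigOperators Topology NNReal ENNReal Classical BoundedContinuousFunction
open Filter Set MeasureTheory Metric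
open Literature.Probability.LatticeModels (HexVertex hexGraph hexCenter triZeta triEmbed Site
  triZeta_sq normSq_triZeta)
open Literature.Probability.RandomPlanarGeometry
open Literature.Probability.RandomPlanarGeometry.SAW

namespace Summit.CriticalPhenomena.SAWScalingLimit.Theorems.ObservableToSLER.BridgeGate

-- BEGIN LOCAL COPY OF GateDefs (`rowCoord`, `rowOf`, `skewCoord` only; delete and `import` the module
-- `Summits.CriticalPhenomena.SAWScalingLimit.Theorems.SAWDefectDecoherenceObservableToSLERGateDefs` once it lands)

/-- The three UNSIGNED zigzag-row coordinates of a honeycomb vertex `v = (x, t)` (cell `x ∈ ℤ²`,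
triangle type `t`): family `0` = horizontal rows, index `x 1` (the row function of
`HexObservableLimitR`'s exact half-lattice clause); family `1` = rows of direction `60°`, index `x 0`;
family `2` = rows of direction `120°`, index `x 0 + x 1 + t`.  The face `v` lies strictly between the
`𝕋`-lines numbered `rowCoord i v` and `rowCoord i v + 1` of family `i`. -/
def rowCoord (i : Fin 3) (v : HexVertex) : ℤ :=
  if i = 0 then v.1 1 else if i = 1 then v.1 0 else v.1 0 + v.1 1 + (v.2 : ℕ)

/-- The six SIGNED row coordinates: `rowOf k` increases in the direction `ζ^k · i` normal to the
lattice lines of direction `ζ^k` (`ζ = e^{iπ/3}`), so that `{v | m ≤ rowOf k v}` is the exact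
half-lattice lying on the side `ζ^k · i` of a `𝕋`-line of direction `ζ^k` — the lattice clause of
`HexObservableLimitR` (`k = 0`: `rowOf 0 v = v.1 1`) in all six orientations. -/
def rowOf (k : Fin 6) (v : HexVertex) : ℤ :=
  ![rowCoord 0 v, -rowCoord 1 v, -rowCoord 2 v, -rowCoord 0 v, rowCoord 1 v, rowCoord 2 v] k

/-- The three skew coordinates of a point of the plane (`z = x₀ + x₁ ζ`): `skewCoord 0 z = x₁`,
`skewCoord 1 z = x₀`, `skewCoord 2 z = x₀ + x₁`; the face centre `hexCenter v` has
`skewCoord i (hexCenter v) ∈ (rowCoord i v, rowCoord i v + 1)`. -/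
def skewCoord (i : Fin 3) (z : ℂ) : ℝ :=
  ![2 * z.im / Real.sqrt 3, z.re - z.im / Real.sqrt 3, z.re + z.im / Real.sqrt 3] i

-- END LOCAL COPY OF GateDefs

/-! ### Powers of `ζ = triZeta` and the sign table of `rowOf` -/

/-- `ζ³ = −1`, `ζ⁴ = −ζ`, `ζ⁵ = 1 − ζ`: with `triZeta_sq : ζ² = ζ − 1` the reductions of all powers of `ζ`
(cf. `triZeta_cube`, `triZeta_pow_four` elsewhere in the tree; bundled here to keep the import light). -/
theorem triZeta_pow_three_four_five :
    triZeta ^ 3 = -1 ∧ triZeta ^ 4 = -triZeta ∧ triZeta ^ 5 = 1 - triZeta := by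
  have h := triZeta_sq
  exact ⟨by linear_combination (triZeta + 1) * h, by linear_combination (triZeta ^ 2 + triZeta) * h,
    by linear_combination (triZeta ^ 3 + triZeta ^ 2 - 1) * h⟩

/-- The six unit vectors `ζ^k` in coordinates: `re ζ^k = (1, ½, −½, −1, −½, ½)_k`,
`im ζ^k = (√3/2)·(0, 1, 1, 0, −1, −1)_k`. -/
theorem triZeta_pow_re_im (k : Fin 6) :
    (triZeta ^ (k : ℕ)).re = (![1, 1 / 2, -1 / 2, -1, -1 / 2, 1 / 2] k : ℝ) ∧
    (triZeta ^ (k : ℕ)).im = Real.sqrt 3 / 2 * (![0, 1, 1, 0, -1, -1] k : ℝ) := by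
  fin_cases k <;> simp [triZeta_sq, triZeta_pow_three_four_five] <;> norm_num

/-- `ζ^{k+3} = −ζ^k` (indices in `Fin 6`): orientation `k + 3` is the opposite side of the same lines. -/
theorem triZeta_pow_add_three (k : Fin 6) :
    triZeta ^ ((k + 3 : Fin 6) : ℕ) = -triZeta ^ (k : ℕ) := by
  fin_cases k <;> simp [triZeta_sq, triZeta_pow_three_four_five]

/-- The sign `σ_k = (1, −1, −1, −1, 1, 1)_k` of the signed row `rowOf k`. -/
def rowSign : Fin 6 → ℤ := ![1, -1, -1, -1, 1, 1]

/-- The row family `j_k = (0, 1, 2, 0, 1, 2)_k` of the signed row `rowOf k`. -/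
def rowAxis : Fin 6 → Fin 3 := ![0, 1, 2, 0, 1, 2]

/-- `rowOf k = σ_k · rowCoord j_k` — the definition of `rowOf`, read through the two tables. -/
theorem rowOf_eq (k : Fin 6) (v : HexVertex) : rowOf k v = rowSign k * rowCoord (rowAxis k) v := by
  fin_cases k <;> simp [rowOf, rowSign, rowAxis]

/-- `σ_k = 1 ∨ σ_k = −1`. -/
theorem rowSign_eq_or (k : Fin 6) : rowSign k = 1 ∨ rowSign k = -1 := by
  fin_cases k <;> simp [rowSign]

/-- **Opposite orientations have opposite signed rows:** `rowOf (k + 3) = −rowOf k`. -/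
theorem rowOf_add_three (k : Fin 6) (v : HexVertex) : rowOf (k + 3) v = -rowOf k v := by
  fin_cases k <;> simp [rowOf]

/-- **The flat clause in skew coordinates:** `im(conj(ζ^k) z) = (√3/2)·σ_k·skewCoord j_k z` with the
SAME table `(σ_k, j_k)` as `rowOf`: `{0 < im(conj(ζ^k)(z − p))}` is the open half-plane where the signed
skew coordinate `σ_k · skewCoord j_k` exceeds its value at `p`. -/
theorem im_conj_triZeta_pow_mul (k : Fin 6) (z : ℂ) :
    ((starRingEnd ℂ) (triZeta ^ (k : ℕ)) * z).im =
      Real.sqrt 3 / 2 * (rowSign k * skewCoord (rowAxis k) z) := by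
  obtain ⟨hre, him⟩ := triZeta_pow_re_im k
  have hmul : ∀ w : ℂ, ((starRingEnd ℂ) w * z).im = w.re * z.im - w.im * z.re := fun w => by
    simp [Complex.mul_im]; ring
  rw [hmul, hre, him]
  have hs0 : 0 < Real.sqrt 3 := Real.sqrt_pos.2 (by norm_num)
  fin_cases k <;> simp [rowSign, rowAxis, skewCoord] <;> field_simp <;> ring

/-! ### Skew coordinates of face centres: `rowCoord` is a floor -/

/-- `skewCoord i (c_v) = rowCoord i v + f_i(v)/3` with `f(v) = (t+1, t+1, 2−t)` for `v = (x, t)`: the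
fractional parts are `1/3` or `2/3`. -/
theorem skewCoord_hexCenter_eq (i : Fin 3) (v : HexVertex) :
    skewCoord i (hexCenter v) =
      rowCoord i v + (![(v.2 : ℕ) + 1, (v.2 : ℕ) + 1, 2 - (v.2 : ℕ)] i : ℝ) / 3 := by
  obtain ⟨x, t⟩ := v
  have hs0 : 0 < Real.sqrt 3 := Real.sqrt_pos.2 (by norm_num)
  have hre : (hexCenter (x, t)).re = x 0 + (x 1 : ℝ) / 2 + ((t : ℕ) + 1) / 2 := by
    simp [hexCenter, triEmbed]; ring
  have him : (hexCenter (x, t)).im = Real.sqrt 3 / 2 * (x 1 + ((t : ℕ) + 1) / 3) := by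
    simp [hexCenter, triEmbed]; ring
  fin_cases i <;> simp [skewCoord, rowCoord, hre, him] <;> field_simp <;> ring

/-- Face centres stay `≥ 1/3` (in skew units) above the lower line of each family … -/
theorem rowCoord_add_third_le_skewCoord (i : Fin 3) (v : HexVertex) :
    (rowCoord i v : ℝ) + 1 / 3 ≤ skewCoord i (hexCenter v) := by
  rw [skewCoord_hexCenter_eq]
  obtain ⟨x, t⟩ := v
  fin_cases i <;> fin_cases t <;> simp <;> norm_num

/-- … and `≥ 1/3` below the upper line. -/
theorem skewCoord_le_rowCoord_add_two_thirds (i : Fin 3) (v : HexVertex) :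
    skewCoord i (hexCenter v) ≤ (rowCoord i v : ℝ) + 2 / 3 := by
  rw [skewCoord_hexCenter_eq]
  obtain ⟨x, t⟩ := v
  fin_cases i <;> fin_cases t <;> simp <;> norm_num

/-- **`rowCoord i v = ⌊skewCoord i (c_v)⌋`:** the face lies strictly between the `𝕋`-lines
`rowCoord i v` and `rowCoord i v + 1` of family `i`. -/
theorem floor_skewCoord_hexCenter (i : Fin 3) (v : HexVertex) :
    ⌊skewCoord i (hexCenter v)⌋ = rowCoord i v := by
  have h1 := rowCoord_add_third_le_skewCoord i v
  have h2 := skewCoord_le_rowCoord_add_two_thirds i v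
  exact Int.floor_eq_iff.2 ⟨by linarith, by linarith⟩

/-- An integer is `≤ rowCoord i v` iff it is `<` the skew coordinate of the centre. -/
theorem le_rowCoord_iff (i : Fin 3) (v : HexVertex) (m : ℤ) :
    m ≤ rowCoord i v ↔ (m : ℝ) < skewCoord i (hexCenter v) := by
  have h1 := rowCoord_add_third_le_skewCoord i v
  have h2 := skewCoord_le_rowCoord_add_two_thirds i v
  constructor
  · intro h
    have : (m : ℝ) ≤ rowCoord i v := by exact_mod_cast h
    linarith
  · intro h
    have : (m : ℝ) < rowCoord i v + 1 := by linarith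
    exact Int.lt_add_one_iff.1 (by exact_mod_cast this)

/-- An integer is `> rowCoord i v` iff it is `>` the skew coordinate of the centre. -/
theorem rowCoord_lt_iff (i : Fin 3) (v : HexVertex) (m : ℤ) :
    rowCoord i v < m ↔ skewCoord i (hexCenter v) < (m : ℝ) := by
  rw [← floor_skewCoord_hexCenter, Int.floor_lt]

/-! ### Consistency of the lattice clause `m ≤ rowOf k ·` with the flat clause -/

/-- The level (value of the normal coordinate `im(conj(ζ^k) ·)`) of the `𝕋`-line of direction `ζ^k`
bounding the half-lattice `{v | m ≤ rowOf k v}`: `(√3/2)(m + (σ_k − 1)/2)`, i.e. `(√3/2) m` for `σ_k = 1`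
and `(√3/2)(m − 1)` for `σ_k = −1` (negative rows are numbered from the line ABOVE the face). -/
def lineLevel (k : Fin 6) (m : ℤ) : ℝ :=
  Real.sqrt 3 / 2 * (m + (rowSign k - 1) / 2)

/-- **CONSISTENCY: the lattice clause of `R6` is the flat clause read on face centres.**
`m ≤ rowOf k v` iff the centre of `v` lies strictly on the side `ζ^k · i` of the `𝕋`-line of
direction `ζ^k` at level `lineLevel k m`. -/
theorem le_rowOf_iff (k : Fin 6) (m : ℤ) (v : HexVertex) :
    m ≤ rowOf k v ↔ lineLevel k m < ((starRingEnd ℂ) (triZeta ^ (k : ℕ)) * hexCenter v).im := by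
  rw [im_conj_triZeta_pow_mul, rowOf_eq, lineLevel, mul_lt_mul_iff_right₀ (by positivity)]
  rcases rowSign_eq_or k with hk | hk <;> rw [hk] <;> push_cast
  · rw [one_mul, one_mul, sub_self, zero_div, add_zero]
    exact le_rowCoord_iff _ v m
  · rw [neg_one_mul, neg_one_mul, show (m : ℝ) + (-1 - 1) / 2 = -((-m + 1 : ℤ) : ℝ) by push_cast; ring,
      neg_lt_neg_iff, ← rowCoord_lt_iff]
    omega

/-- The complementary clause: `rowOf k v < m` iff the centre lies strictly on the side `−ζ^k · i`. -/
theorem rowOf_lt_iff (k : Fin 6) (m : ℤ) (v : HexVertex) :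
    rowOf k v < m ↔ ((starRingEnd ℂ) (triZeta ^ (k : ℕ)) * hexCenter v).im < lineLevel k m := by
  rw [im_conj_triZeta_pow_mul, rowOf_eq, lineLevel, mul_lt_mul_iff_right₀ (by positivity)]
  rcases rowSign_eq_or k with hk | hk <;> rw [hk] <;> push_cast
  · rw [one_mul, one_mul, sub_self, zero_div, add_zero]
    exact rowCoord_lt_iff _ v m
  · rw [neg_one_mul, neg_one_mul, show (m : ℝ) + (-1 - 1) / 2 = -((-m + 1 : ℤ) : ℝ) by push_cast; ring,
      neg_lt_neg_iff, ← le_rowCoord_iff]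
    omega

/-- **REGISTERED SUB-GOAL `stub_orientationConsistency` of the crux item (line `bridge-gate-renewal`):**
the consistency `le_rowOf_iff` with the threshold written out over the line's vocabulary only —
`m ≤ rowOf k v ↔ (√3/2)(m + s_k) < im(conj(ζ^k) c_v)`, shift table `s = (0, −1, −1, −1, 0, 0)`. -/
theorem stub_orientationConsistency :
    ∀ (k : Fin 6) (m : ℤ) (v : HexVertex), m ≤ rowOf k v ↔
      Real.sqrt 3 / 2 * ((m : ℝ) + (![0, -1, -1, -1, 0, 0] : Fin 6 → ℝ) k) <
        ((starRingEnd ℂ) (triZeta ^ (k : ℕ)) * hexCenter v).im := by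
  intro k m v
  rw [le_rowOf_iff, lineLevel]
  fin_cases k <;> simp [rowSign] <;> norm_num

/-- **No centre on a line, quantitatively:** every face centre has normal distance `≥ √3/6` from
every `𝕋`-line `{im(conj(ζ^k) z) = lineLevel k m}`. -/
theorem abs_im_sub_lineLevel_ge (k : Fin 6) (m : ℤ) (v : HexVertex) :
    Real.sqrt 3 / 6 ≤ |((starRingEnd ℂ) (triZeta ^ (k : ℕ)) * hexCenter v).im - lineLevel k m| := by
  rw [im_conj_triZeta_pow_mul, lineLevel, ← mul_sub, abs_mul, abs_of_pos (by positivity),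
    show Real.sqrt 3 / 6 = Real.sqrt 3 / 2 * (1 / 3) by ring]
  refine mul_le_mul_of_nonneg_left ?_ (by positivity)
  have h1 := rowCoord_add_third_le_skewCoord (rowAxis k) v
  have h2 := skewCoord_le_rowCoord_add_two_thirds (rowAxis k) v
  rw [le_abs]
  rcases rowSign_eq_or k with hk | hk <;> rw [hk] <;> push_cast
  · rcases le_or_gt m (rowCoord (rowAxis k) v) with h | h
    · have : (m : ℝ) ≤ rowCoord (rowAxis k) v := by exact_mod_cast h
      left; linarith
    · have : (rowCoord (rowAxis k) v : ℝ) + 1 ≤ m := by exact_mod_cast h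
      right; linarith
  · rcases le_or_gt (1 - m) (rowCoord (rowAxis k) v) with h | h
    · have : (1 : ℝ) - m ≤ rowCoord (rowAxis k) v := by exact_mod_cast h
      right; linarith
    · have : (rowCoord (rowAxis k) v : ℝ) + 1 ≤ 1 - m := by exact_mod_cast h
      left; linarith

/-! ### Gates: the class of a honeycomb edge -/

/-- **Master computation along a honeycomb edge.**  For adjacent faces `p ~ q` there is a class `k₀`
(the up triangle `(x, 0)` is adjacent to the down triangles `(x, 1)`, `(x − e₀, 1)`, `(x − e₁, 1)`:
classes `5`, `1`, `3`; reversed edges: the antipodes `2`, `4`, `0`) such that `rowOf k₀` increases by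
`1` from `p` to `q`, `rowOf (k₀ + 3)` drops by `1`, the other four are unchanged, and the dual edge is
the unit normal `c_q − c_p = (i/√3) · ζ^{k₀}`. -/
theorem gate_data {p q : HexVertex} (h : hexGraph.Adj p q) :
    ∃ k₀ : Fin 6, (∀ k : Fin 6, rowOf k q - rowOf k p =
        if k = k₀ then 1 else if k = k₀ + 3 then -1 else 0) ∧
      hexCenter q - hexCenter p = Complex.I / (Real.sqrt 3 : ℂ) * triZeta ^ (k₀ : ℕ) := by
  have hs : Real.sqrt 3 * Real.sqrt 3 = 3 := Real.mul_self_sqrt (by norm_num)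
  have hs0 : 0 < Real.sqrt 3 := Real.sqrt_pos.2 (by norm_num)
  have hc : ∀ (w : Site 2) (t : Fin 2), hexCenter (w, t) =
      ⟨w 0 + (w 1 : ℝ) / 2 + ((t : ℕ) + 1) / 2, Real.sqrt 3 / 2 * (w 1 + ((t : ℕ) + 1) / 3)⟩ := by
    intro w t
    apply Complex.ext <;> simp [hexCenter, triEmbed] <;> ring
  have key : ∀ (k₀ : Fin 6) (w : ℂ), w.re * Real.sqrt 3 = -(triZeta ^ (k₀ : ℕ)).im →
      w.im * Real.sqrt 3 = (triZeta ^ (k₀ : ℕ)).re →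
      w = Complex.I / (Real.sqrt 3 : ℂ) * triZeta ^ (k₀ : ℕ) := by
    intro k₀ w h1 h2
    rw [div_mul_eq_mul_div, eq_div_iff (Complex.ofReal_ne_zero.2 hs0.ne'), Complex.ext_iff]
    constructor
    · simpa [Complex.mul_re] using h1
    · simpa [Complex.mul_im] using h2
  have hz := And.intro triZeta_sq triZeta_pow_three_four_five
  obtain ⟨x, i⟩ := p
  obtain ⟨y, j⟩ := q
  rw [hexGraph_adj_iff_coord] at h
  rcases h with ⟨rfl, rfl, ⟨h0, h1⟩ | ⟨h0, h1⟩ | ⟨h0, h1⟩⟩ | ⟨rfl, rfl, ⟨h0, h1⟩ | ⟨h0, h1⟩ | ⟨h0, h1⟩⟩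
  · refine ⟨5, fun k => ?_, key _ _ ?_ ?_⟩
    · fin_cases k <;> simp [rowOf, rowCoord, h0, h1]
    · simp [hc, h0, h1, hz]; ring
    · simp [hc, h0, h1, hz]; nlinarith [hs]
  · refine ⟨1, fun k => ?_, key _ _ ?_ ?_⟩
    · fin_cases k <;> simp [rowOf, rowCoord, h0, h1] <;> omega
    · simp [hc, h0, h1]; ring
    · simp [hc, h0, h1]; nlinarith [hs]
  · refine ⟨3, fun k => ?_, key _ _ ?_ ?_⟩
    · fin_cases k <;> simp [rowOf, rowCoord, h0, h1] <;> omega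
    · simp [hc, h0, h1, hz]; ring
    · simp [hc, h0, h1, hz]; nlinarith [hs]
  · refine ⟨2, fun k => ?_, key _ _ ?_ ?_⟩
    · fin_cases k <;> simp [rowOf, rowCoord, h0, h1]
    · simp [hc, h0, h1, hz]; ring
    · simp [hc, h0, h1, hz]; nlinarith [hs]
  · refine ⟨4, fun k => ?_, key _ _ ?_ ?_⟩
    · fin_cases k <;> simp [rowOf, rowCoord, h0, h1] <;> omega
    · simp [hc, h0, h1, hz]; ring
    · simp [hc, h0, h1, hz]; nlinarith [hs]
  · refine ⟨0, fun k => ?_, key _ _ ?_ ?_⟩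
    · fin_cases k <;> simp [rowOf, rowCoord, h0, h1] <;> omega
    · simp [hc, h0, h1]; ring
    · simp [hc, h0, h1]; nlinarith [hs]

/-- **Each honeycomb edge crosses exactly one line family, in one direction:** for adjacent faces
`p ~ q` there is exactly one orientation `k : Fin 6` with `rowOf k q = rowOf k p + 1`. -/
theorem existsUnique_gateClass {p q : HexVertex} (h : hexGraph.Adj p q) :
    ∃! k : Fin 6, rowOf k q = rowOf k p + 1 := by
  obtain ⟨k₀, H, -⟩ := gate_data h
  refine ⟨k₀, by have := H k₀; simp at this; omega, fun k hk => ?_⟩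
  have := H k
  split_ifs at this with h1 h2 <;> first | exact h1 | omega

/-- **The dual edge of a gate is the unit normal of its class:** if `rowOf k q = rowOf k p + 1` for
adjacent `p ~ q`, then `c_q − c_p = (i/√3) · ζ^k` (length `1/√3`, direction `ζ^k · i`). -/
theorem hexCenter_sub_hexCenter_of_gate {p q : HexVertex} (h : hexGraph.Adj p q) {k : Fin 6}
    (hk : rowOf k q = rowOf k p + 1) :
    hexCenter q - hexCenter p = Complex.I / (Real.sqrt 3 : ℂ) * triZeta ^ (k : ℕ) := by
  obtain ⟨k₀, H, hc⟩ := gate_data h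
  obtain rfl : k = k₀ := by
    have := H k
    split_ifs at this with h1 h2 <;> first | exact h1 | omega
  exact hc

/-- For a gate of class `k` the normal coordinate increases by exactly `1/√3` from `c_p` to `c_q`. -/
theorem im_conj_triZeta_pow_mul_sub_of_gate {p q : HexVertex} (h : hexGraph.Adj p q) {k : Fin 6}
    (hk : rowOf k q = rowOf k p + 1) :
    ((starRingEnd ℂ) (triZeta ^ (k : ℕ)) * (hexCenter q - hexCenter p)).im = (Real.sqrt 3)⁻¹ := by
  have hu : (starRingEnd ℂ) (triZeta ^ (k : ℕ)) * triZeta ^ (k : ℕ) = 1 := by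
    rw [mul_comm, Complex.mul_conj, map_pow, normSq_triZeta, one_pow, Complex.ofReal_one]
  rw [hexCenter_sub_hexCenter_of_gate h hk, mul_comm, mul_assoc, mul_comm (triZeta ^ (k : ℕ)), hu,
    mul_one, Complex.div_ofReal_im, Complex.I_im, one_div]

/-- **The gate point lies ON the separating line:** for a gate of class `k` the mid-edge
`hexMidpoint s(p, q) = (c_p + c_q)/2` (`= gatePoint 1 p q`) has normal coordinate exactly
`lineLevel k (rowOf k p + 1)`, the level separating `{rowOf k · ≤ rowOf k p}` from
`{rowOf k p + 1 ≤ rowOf k ·}` (both centres are at normal distance exactly `√3/6` from it). -/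
theorem im_conj_triZeta_pow_mul_hexMidpoint {p q : HexVertex} (h : hexGraph.Adj p q) {k : Fin 6}
    (hk : rowOf k q = rowOf k p + 1) :
    ((starRingEnd ℂ) (triZeta ^ (k : ℕ)) * hexMidpoint s(p, q)).im = lineLevel k (rowOf k p + 1) := by
  have hs : Real.sqrt 3 * Real.sqrt 3 = 3 := Real.mul_self_sqrt (by norm_num)
  have hs0 : 0 < Real.sqrt 3 := Real.sqrt_pos.2 (by norm_num)
  have h1 := (rowOf_lt_iff k (rowOf k p + 1) p).1 (by omega)
  have h2 := (le_rowOf_iff k (rowOf k p + 1) q).1 (by omega)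
  have h3 := abs_im_sub_lineLevel_ge k (rowOf k p + 1) p
  have h4 := abs_im_sub_lineLevel_ge k (rowOf k p + 1) q
  rw [abs_of_neg (by linarith)] at h3
  rw [abs_of_pos (by linarith)] at h4
  have h5 := im_conj_triZeta_pow_mul_sub_of_gate h hk
  rw [mul_sub, Complex.sub_im] at h5
  have h6 : (Real.sqrt 3)⁻¹ = Real.sqrt 3 / 6 + Real.sqrt 3 / 6 := by
    field_simp; linarith
  have hmid : ((starRingEnd ℂ) (triZeta ^ (k : ℕ)) * hexMidpoint s(p, q)).im =
      (((starRingEnd ℂ) (triZeta ^ (k : ℕ)) * hexCenter p).im +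
        ((starRingEnd ℂ) (triZeta ^ (k : ℕ)) * hexCenter q).im) / 2 := by
    rw [hexMidpoint_mk, mul_div_assoc', Complex.div_ofNat_im, mul_add, Complex.add_im]
  rw [hmid]
  linarith

/-- **The far half-lattice of a gate is the flat clause of `R6` at the gate point (mesh `1`):**
`rowOf k p < rowOf k v ↔ 0 < im(conj(ζ^k) (c_v − hexMidpoint s(p, q)))`. -/
theorem rowOf_lt_rowOf_iff_of_gate {p q : HexVertex} (h : hexGraph.Adj p q) {k : Fin 6}
    (hk : rowOf k q = rowOf k p + 1) (v : HexVertex) :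
    rowOf k p < rowOf k v ↔
      0 < ((starRingEnd ℂ) (triZeta ^ (k : ℕ)) * (hexCenter v - hexMidpoint s(p, q))).im := by
  rw [mul_sub, Complex.sub_im, sub_pos, im_conj_triZeta_pow_mul_hexMidpoint h hk, ← le_rowOf_iff]
  omega

/-- The same at mesh `δ > 0`, literally in the shape of `R6`'s two clauses: with the marked point
`P = δ · hexMidpoint s(p, q)` (`= gatePoint δ p q`) and `m = rowOf k p + 1`,
`m ≤ rowOf k v ↔ 0 < im(conj(ζ^k) (δ c_v − P))`. -/
theorem rowOf_lt_rowOf_iff_of_gate_smul {p q : HexVertex} (h : hexGraph.Adj p q) {k : Fin 6}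
    (hk : rowOf k q = rowOf k p + 1) {δ : ℝ} (hδ : 0 < δ) (v : HexVertex) :
    rowOf k p + 1 ≤ rowOf k v ↔
      0 < ((starRingEnd ℂ) (triZeta ^ (k : ℕ)) *
        ((δ : ℂ) * hexCenter v - (δ : ℂ) * hexMidpoint s(p, q))).im := by
  rw [← mul_sub, mul_left_comm, Complex.im_ofReal_mul, mul_pos_iff_of_pos_left hδ,
    ← rowOf_lt_rowOf_iff_of_gate h hk]
  omega

/-- The root side of a gate, complementarily: `rowOf k v ≤ rowOf k p ↔ im(conj(ζ^k)(c_v − g)) < 0`. -/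
theorem rowOf_le_rowOf_iff_of_gate {p q : HexVertex} (h : hexGraph.Adj p q) {k : Fin 6}
    (hk : rowOf k q = rowOf k p + 1) (v : HexVertex) :
    rowOf k v ≤ rowOf k p ↔
      ((starRingEnd ℂ) (triZeta ^ (k : ℕ)) * (hexCenter v - hexMidpoint s(p, q))).im < 0 := by
  rw [mul_sub, Complex.sub_im, sub_neg, im_conj_triZeta_pow_mul_hexMidpoint h hk, ← rowOf_lt_iff]
  omega

end Summit.CriticalPhenomena.SAWScalingLimit.Theorems.ObservableToSLER.BridgeGate

end
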